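import Literature.IUT.LogThetaLattice.GlobalPacketsLGP
import Literature.IUT.LogThetaLattice.TensorPackets
import Literature.IUT.LogVolume.FakeAdeleIndex
import Mathlib.RingTheory.DedekindDomain.AdicValuation
import Mathlib.NumberTheory.NumberField.Completion.InfinitePlace
import Mathlib.NumberTheory.NumberField.Completion.FinitePlace
import Mathlib.LinearAlgebra.Basis.VectorSpace
import Mathlib.Algebra.Algebra.Rat
import HarnessLib

/-!
# [IUTchIII] Proposition 3.3 (i) (localization homomorphism), (ii) (integers): the number-field MODEL

S. Mochizuki, *Inter-universal Teichmüller theory III*, kurims manuscript (May 2020), §3, Proposition 3.3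
"(Global Tensor Packets)", p. 100 [claim: Mochizuki2012, status: disputed] (D-0012 claim key; the content
proved here is classical algebraic number theory). Companion of `GlobalPacketsLGP.lean` (abc-iut-L6-t4),
whose `LocalizationHom` is an INTERFACE ("the construction needs [IUTchII] Cor. 4.8 (iii) and [IUTchIII]
Def. 1.1") and whose integrality clauses `Prop33ii_integersNon` / `Prop33ii_integersArc` are predicates over
it and over abstract integral structures ("SLOTS (nothing to prove until the localization homomorphism is
constructed)", `GlobalPacketsLGPProofs.lean`). abc-iut cell, wave 4 (seat abc-iut-w4-d037); nodes
**IUTchIII:Prop3.3(i)** (second sentence) and **IUTchIII:Prop3.3(ii)**.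

THIS FILE CONSTRUCTS the localization homomorphism in the model of [IUTchIII] Rmk. 3.1.1 (i) / [IUTchII]
Cor. 4.8 (i)–(iii) in which every labelled number field `(†𝕄⊛_mod)_α`, `α ∈ A`, is a copy of ONE number
field `K = F_mod` and the local data at `v | v_ℚ` are the completions `K_v` (Mathlib `adicCompletion` at the
finite places over `p`, indexed by `Literature.IUT.LogVolume.placesOver K p`; `InfinitePlace.Completion` at
the archimedean places), tensor packets over `ℚ` ("topological tensor product [say, over `ℚ`]", Rmk. 3.1.1
(i) p. 94; cf. `Literature.IUT.LogVolume.RationalPacketComparison`):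
* `𝕍_ℚ ↦ VQ := Option Nat.Primes` (`none` = the archimedean place), `IsNon`/`IsArc`; fibre `Idx K v_ℚ`;
  `log(^α𝓕_v) ↦ K_v = Cpl K v_ℚ v`; `log(^α𝓕_{v_ℚ}) = ⊕_{v|v_ℚ} K_v ↦ Loc K v_ℚ`; `log(^A𝓕_{v_ℚ}) ↦
  packet K A v_ℚ := PacketN ℚ (fun _ v => K_v)` — abc-iut-L6-t4's `PacketN` (Prop. 3.1) BY NAME;
* `diag : K → Π_{v|v_ℚ} K_v`, `locAt v_ℚ : ⊗_α K → ⊗_α (Π_v K_v)` (tensor product of algebra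
  homomorphisms, `piTensorMapAlg`), `localizationHom K A : LocalizationHom (fun _ : A => K) (packet K A)` —
  an INSTANCE of the interface with the printed **"injective"** PROVED (`locAt_injective`: a `ℚ`-linear
  retraction of the diagonal tensors to a retraction);
* integral structures: at `v_ℚ = p` the subring `integralPacket` generated by the pure tensors of `v`-adic
  integers ("formed by suitable direct sums and tensor products", Prop. 3.1 (ii) / 3.2 (ii); cf.
  `ratPacketDistrib_map_closure_integral` in `RationalPacketComparison`); at `v_ℚ = ∞` the set
  `integralPureTensors` of pure tensors of vectors of absolute value `≤ 1` ("the direct product of subsets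
  constituted by the integral structures [unit balls] on the various direct summand … fields");
* **IUTchIII:Prop3.3(ii)** DISCHARGED for the model: `prop33ii_integersNon_model` (a global integer is a local
  integer, Mathlib `coe_mem_adicCompletionIntegers`), `prop33ii_integersArc_model` (`‖x‖_{K_v} = v(x) =
  ‖σ_v(x)‖`), with the FULLY-QUALIFIED types of abc-iut-L6-t4's predicates; NON-VACUITY:
  `locAt_single_inv_prime_not_mem` (`p⁻¹` is NOT sent into `integralPacket` at `v_ℚ = p`).

NOT modelled (honest scope): the identification of the labels with `F_mod` via the Kummer isomorphisms of
[IUTchII] Cor. 4.8 (ii) and the passage through the log-links of [IUTchIII] Def. 1.1 (the interface's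
provenance) — the labels carry literal copies of `K`; the algebraic closures `k̄` of Rmk. 3.1.1 (i) are
replaced by the completions `K_v` (Prop. 3.3 (i)/(ii) concern the image of `K` only). Nothing here bears on
the disputed [IUTchIII] Cor. 3.12; typed ≠ endorsed.
-/

noncomputable section

namespace Literature.IUT.LogThetaLattice

open IsDedekindDomain NumberField PiTensorProduct
open scoped TensorProduct

/-! ### A tensor product of algebra homomorphisms (generic) -/

section PiTensorMapAlg

variable {ι : Type*} {R : Type*} [CommSemiring R] {M N : ι → Type*}
  [∀ i, CommSemiring (M i)] [∀ i, Algebra R (M i)] [∀ i, CommSemiring (N i)] [∀ i, Algebra R (N i)]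

/-- The tensor product `⊗_i f_i : ⊗_i M_i →ₐ ⊗_i N_i` of a family of algebra homomorphisms (its underlying
linear map is `PiTensorProduct.map`). [folklore] -/
private def piTensorMapAlg (f : ∀ i, M i →ₐ[R] N i) : (⨂[R] i, M i) →ₐ[R] ⨂[R] i, N i :=
  PiTensorProduct.liftAlgHom ((PiTensorProduct.tprod R).compLinearMap fun i => (f i).toLinearMap)
    (by
      simp only [MultilinearMap.compLinearMap_apply, AlgHom.toLinearMap_apply, Pi.one_apply, map_one]
      rfl)
    (fun x y => by
      simp only [MultilinearMap.compLinearMap_apply, AlgHom.toLinearMap_apply, Pi.mul_apply, map_mul]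
      rw [PiTensorProduct.tprod_mul_tprod]
      rfl)

/-- `⊗_i f_i` on pure tensors. [folklore] -/
@[simp] private theorem piTensorMapAlg_tprod (f : ∀ i, M i →ₐ[R] N i) (x : ∀ i, M i) :
    piTensorMapAlg f (PiTensorProduct.tprod R x) = PiTensorProduct.tprod R fun i => f i (x i) := by
  simp only [piTensorMapAlg, PiTensorProduct.liftAlgHom_apply, PiTensorProduct.lift.tprod,
    MultilinearMap.compLinearMap_apply, AlgHom.toLinearMap_apply]

/-- The underlying linear map of `⊗_i f_i` is `PiTensorProduct.map`. [folklore] -/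
private theorem piTensorMapAlg_toLinearMap (f : ∀ i, M i →ₐ[R] N i) :
    (piTensorMapAlg f).toLinearMap = PiTensorProduct.map fun i => (f i).toLinearMap := by
  ext x
  simp [piTensorMapAlg]

/-- If every `f_i` admits an `R`-linear retraction then so does `⊗_i f_i`; in particular `⊗_i f_i` is
injective. [folklore] -/
private theorem piTensorMapAlg_injective_of_leftInverse (f : ∀ i, M i →ₐ[R] N i)
    (g : ∀ i, N i →ₗ[R] M i) (hg : ∀ i, (g i) ∘ₗ (f i).toLinearMap = LinearMap.id) :
    Function.Injective (piTensorMapAlg f) := by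
  have h : (PiTensorProduct.map g) ∘ₗ (piTensorMapAlg f).toLinearMap = LinearMap.id := by
    rw [piTensorMapAlg_toLinearMap, ← PiTensorProduct.map_comp]
    simpa only [hg] using PiTensorProduct.map_id
  exact Function.LeftInverse.injective (g := PiTensorProduct.map g) fun x => LinearMap.congr_fun h x

end PiTensorMapAlg

/-! ### The model: places, completions, packets -/

namespace LocalizationModel

variable (K : Type) [Field K] [NumberField K]
/-- `𝕍_ℚ = 𝕍(ℚ)`: the rational primes (`some p`) and the archimedean place (`none`).
[claim: Mochizuki2012, status: disputed] -/
abbrev VQ : Type := Option Nat.Primes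

/-- `𝕍_ℚ^non`. [claim: Mochizuki2012, status: disputed] -/
def IsNon (vQ : VQ) : Prop := vQ.isSome

/-- `𝕍_ℚ^arc`. [claim: Mochizuki2012, status: disputed] -/
def IsArc (vQ : VQ) : Prop := vQ = none

/-- The fibre `{v ∈ 𝕍(K) | v | v_ℚ}`: the finite places of `K` over `p` (`placesOver K p`) resp. the
infinite places of `K`. [claim: Mochizuki2012, status: disputed] -/
@[reducible] def Idx : VQ → Type
  | none => InfinitePlace K
  | some p => ↥(Literature.IUT.LogVolume.placesOver K p)

/-- The completion `K_v` at a place `v | v_ℚ` (`v`-adic completion resp. archimedean completion).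
[claim: Mochizuki2012, status: disputed] -/
@[reducible] def Cpl : (vQ : VQ) → Idx K vQ → Type
  | none, w => w.Completion
  | some _, v => v.1.adicCompletion K

/-- `K_v` is a field (by cases on the place; plumbing). [folklore] -/
instance instFieldCpl : (vQ : VQ) → (i : Idx K vQ) → Field (Cpl K vQ i)
  | none, w => inferInstanceAs (Field (InfinitePlace.Completion w))
  | some _, v => inferInstanceAs (Field (v.1.adicCompletion K))

/-- `K_v` is a `ℚ`-algebra (plumbing). [folklore] -/
instance instAlgebraRatCpl : (vQ : VQ) → (i : Idx K vQ) → Algebra ℚ (Cpl K vQ i)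
  | none, w => inferInstanceAs (Algebra ℚ (InfinitePlace.Completion w))
  | some _, v => inferInstanceAs (Algebra ℚ (v.1.adicCompletion K))

/-- `K_v` is a `K`-algebra: the embedding `K → K_v` (plumbing). [folklore] -/
instance instAlgebraCpl : (vQ : VQ) → (i : Idx K vQ) → Algebra K (Cpl K vQ i)
  | none, w => inferInstanceAs (Algebra K (InfinitePlace.Completion w))
  | some _, v => inferInstanceAs (Algebra K (v.1.adicCompletion K))

/-- The fibre over `v_ℚ` is finite (plumbing). [folklore] -/
instance instFintypeIdx : (vQ : VQ) → Fintype (Idx K vQ)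
  | none => inferInstanceAs (Fintype (InfinitePlace K))
  | some p => inferInstanceAs (Fintype ↥(Literature.IUT.LogVolume.placesOver K p))

/-- Decidable equality of places (classical; plumbing). [folklore] -/
instance instDecidableEqIdx (vQ : VQ) : DecidableEq (Idx K vQ) := Classical.decEq _

/-- The fibre over `v_ℚ` is nonempty: every number field has a place over every place of `ℚ`
(`placesOver_nonempty`; infinite places exist). [folklore] -/
instance instNonemptyIdx : (vQ : VQ) → Nonempty (Idx K vQ)
  | none => (inferInstance : Nonempty (InfinitePlace K))
  | some p => haveI : Fact p.1.Prime := ⟨p.2⟩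
      (Literature.IUT.LogVolume.placesOver_nonempty K p.1).coe_sort

/-- The `1`-tensor packet factor `log(^α𝓕_{v_ℚ}) = ⊕_{v | v_ℚ} K_v` of the model ([IUTchIII] Prop. 3.1,
first display; Rmk. 3.1.1 (i)). [claim: Mochizuki2012, status: disputed] -/
abbrev Loc (vQ : VQ) : Type := ∀ i : Idx K vQ, Cpl K vQ i

variable (A : Type)

/-- The `n`-tensor packet `log(^A𝓕_{v_ℚ}) = ⊗_{α∈A} log(^α𝓕_{v_ℚ})` of the model: abc-iut-L6-t4's `PacketN`
over `ℚ` with `L α v := K_v`. [claim: Mochizuki2012, status: disputed] -/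
abbrev packet (vQ : VQ) : Type := PacketN ℚ (fun (_ : A) (i : Idx K vQ) => Cpl K vQ i)

/-! ### The localization homomorphism -/

/-- The diagonal `K → Π_{v | v_ℚ} K_v`, `x ↦ (x)_v`, as a `ℚ`-algebra homomorphism.
[claim: Mochizuki2012, status: disputed] -/
def diag (vQ : VQ) : K →ₐ[ℚ] Loc K vQ :=
  (RingHom.pi fun i : Idx K vQ => algebraMap K (Cpl K vQ i)).toRatAlgHom

/-- `diag` evaluated. [claim: Mochizuki2012, status: disputed] -/
@[simp] theorem diag_apply (vQ : VQ) (x : K) (i : Idx K vQ) :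
    diag K vQ x i = algebraMap K (Cpl K vQ i) x := rfl

/-- The diagonal is injective (a ring homomorphism out of a field into a nonzero ring).
[claim: Mochizuki2012, status: disputed] -/
theorem diag_injective (vQ : VQ) : Function.Injective (diag K vQ) :=
  RingHom.pi_injective (fun i : Idx K vQ => algebraMap K (Cpl K vQ i))
    fun i => (algebraMap K (Cpl K vQ i)).injective

/-- The component at `v_ℚ` of the localization homomorphism of [IUTchIII] Prop. 3.3 (i):
`(†𝕄⊛_mod)_A = ⊗_{α∈A} K → log(^A𝓕_{v_ℚ}) = ⊗_{α∈A} (Π_{v|v_ℚ} K_v)`, the tensor product of the diagonals.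
[claim: Mochizuki2012, status: disputed] -/
def locAt (vQ : VQ) : GlobalPacket (fun _ : A => K) →ₐ[ℚ] packet K A vQ :=
  piTensorMapAlg fun _ : A => diag K vQ

/-- `locAt` on pure tensors: `⊗_α x_α ↦ ⊗_α (x_α)_v`. [claim: Mochizuki2012, status: disputed] -/
@[simp] theorem locAt_tprod (vQ : VQ) (x : A → K) :
    locAt K A vQ (PiTensorProduct.tprod ℚ x) = PiTensorProduct.tprod ℚ fun α => diag K vQ (x α) :=
  piTensorMapAlg_tprod _ _

/-- **IUTchIII:Prop3.3(i)** (p. 100, second sentence, at one `v_ℚ`): the component `locAt v_ℚ` of the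
localization homomorphism is INJECTIVE — the diagonal `K → Π_v K_v` has a `ℚ`-linear retraction (it is
an injective linear map of `ℚ`-vector spaces), and retractions tensor to a retraction.
[claim: Mochizuki2012, status: disputed] -/
theorem locAt_injective (vQ : VQ) : Function.Injective (locAt K A vQ) := by
  have hker : LinearMap.ker (diag K vQ).toLinearMap = ⊥ :=
    LinearMap.ker_eq_bot.mpr (diag_injective K vQ)
  obtain ⟨g, hg⟩ := LinearMap.exists_leftInverse_of_injective (diag K vQ).toLinearMap hker
  exact piTensorMapAlg_injective_of_leftInverse (fun _ : A => diag K vQ) (fun _ => g) fun _ => hg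

/-- **IUTchIII:Prop3.3(i)** (p. 100, second sentence): "a natural injective localization ring
homomorphism `(†𝕄⊛_mod)_A → log(^A𝓕_{𝕍_ℚ}) := Π_{v_ℚ ∈ 𝕍_ℚ} log(^A𝓕_{v_ℚ})`" — the model INSTANCE of
abc-iut-L6-t4's interface `LocalizationHom`, with injectivity PROVED. [claim: Mochizuki2012, status: disputed] -/
def localizationHom : LocalizationHom (fun _ : A => K) (packet K A) where
  toRingHom := RingHom.pi fun vQ => (locAt K A vQ).toRingHom
  injective := RingHom.pi_injective (fun vQ => (locAt K A vQ).toRingHom) fun vQ => locAt_injective K A vQ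

/-- The localization homomorphism, component at `v_ℚ`. [claim: Mochizuki2012, status: disputed] -/
@[simp] theorem localizationHom_apply (x : GlobalPacket (fun _ : A => K)) (vQ : VQ) :
    (localizationHom K A).toRingHom x vQ = locAt K A vQ x := rfl

/-! ### Integral structures -/

/-- Integrality of an element of `K_v`: a `v`-adic integer at a finite place, an element of absolute
value `≤ 1` at an archimedean place ([IUTchIII] Rmk. 3.1.1 (i): `Ψ_{log(^α𝓕_v)} ≅ 𝒪_{k̄}`; Prop. 3.3 (ii):
"archimedean integers [i.e., elements of absolute value `≤ 1` …]"). [claim: Mochizuki2012, status: disputed] -/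
def IsInt : (vQ : VQ) → (i : Idx K vQ) → Cpl K vQ i → Prop
  | none, _, z => ‖z‖ ≤ 1
  | some _, v, z => z ∈ v.1.adicCompletionIntegers K

/-- The pure tensors `⊗_α y_α` of integral vectors `y_α ∈ Π_{v|v_ℚ} 𝒪_{K_v}` of the `n`-packet at `v_ℚ`
(at `v_ℚ = ∞`: of vectors of absolute value `≤ 1` — the archimedean integral structure of Prop. 3.3 (ii)).
[claim: Mochizuki2012, status: disputed] -/
def integralPureTensors (vQ : VQ) : Set (packet K A vQ) :=
  {t | ∃ y : A → Loc K vQ, (∀ α i, IsInt K vQ i (y α i)) ∧ t = PiTensorProduct.tprod ℚ y}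

/-- The integral structure on `log(^A𝓕_{v_ℚ})` "formed by suitable direct sums and tensor products" of
the local integral structures ([IUTchIII] Prop. 3.1 (ii), Prop. 3.2 (ii) p. 98): the subring generated
by the pure tensors of integral vectors. [claim: Mochizuki2012, status: disputed] -/
def integralPacket (vQ : VQ) : Subring (packet K A vQ) :=
  Subring.closure (integralPureTensors K A vQ)

/-- A global integer is a local integer: for `x ∈ 𝓞_K` and a finite place `v`, `(x)_v ∈ 𝒪_{K_v}`
(Mathlib `coe_mem_adicCompletionIntegers`). [folklore] -/
private theorem isInt_diag_some (p : Nat.Primes) (x : 𝓞 K) (i : Idx K (some p)) :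
    IsInt K (some p) i (diag K (some p) (x : K) i) := by
  show ((x : K) : i.1.adicCompletion K) ∈ i.1.adicCompletionIntegers K
  exact HeightOneSpectrum.coe_mem_adicCompletionIntegers (K := K) i.1 x

/-- An "archimedean integer" is integral at every archimedean completion: if `‖σ x‖ ≤ 1` for every
complex embedding `σ`, then `‖(x)_w‖ = w(x) ≤ 1` for every infinite place `w`
(`InfinitePlace.Completion.norm_coe`, `InfinitePlace.norm_embedding_eq`). [folklore] -/
private theorem isInt_diag_none (x : K) (hx : ∀ σ : K →+* ℂ, ‖σ x‖ ≤ 1) (w : Idx K none) :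
    IsInt K none w (diag K none x w) := by
  show ‖(algebraMap K (InfinitePlace.Completion w) x)‖ ≤ 1
  rw [InfinitePlace.Completion.algebraMap_apply,
    show ((x : K) : InfinitePlace.Completion w) =
      ((WithAbs.toAbs (w : InfinitePlace K).1 x : WithAbs (w : InfinitePlace K).1) :
        InfinitePlace.Completion w) from rfl,
    InfinitePlace.Completion.norm_coe]
  show (w : InfinitePlace K) x ≤ 1
  rw [← InfinitePlace.norm_embedding_eq]
  exact hx _

/-- `1 ∈ K_v` is integral at every place. [folklore] -/
private theorem isInt_one (vQ : VQ) (i : Idx K vQ) : IsInt K vQ i 1 := by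
  cases vQ with
  | none => show ‖(1 : InfinitePlace.Completion i)‖ ≤ 1; simp
  | some p => show (1 : i.1.adicCompletion K) ∈ i.1.adicCompletionIntegers K; exact one_mem _

/-- The image of `x ∈ (†𝕄⊛_mod)_α` under `(†𝕄⊛_mod)_α → (†𝕄⊛_mod)_A → log(^A𝓕_{v_ℚ})` is the pure tensor with
`(x)_v` in the factor `α` and `1` elsewhere. [claim: Mochizuki2012, status: disputed] -/
theorem locAt_single [DecidableEq A] (vQ : VQ) (α : A) (x : K) :
    locAt K A vQ (GlobalPacket.single (fun _ : A => K) α x) =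
      PiTensorProduct.tprod ℚ (Pi.mulSingle (M := fun _ : A => Loc K vQ) α (diag K vQ x)) := by
  rw [GlobalPacket.single, PiTensorProduct.singleAlgHom_apply, MonoidHom.mulSingle_apply, locAt_tprod]
  congr 1
  funext β
  by_cases h : β = α
  · subst h; simp
  · simp [Pi.mulSingle_eq_of_ne h, map_one]

/-! ### Proposition 3.3 (ii) for the model -/

/-- **IUTchIII:Prop3.3(ii)** (p. 100), nonarchimedean clause, DISCHARGED for the model: "for each
`v_ℚ ∈ 𝕍_ℚ^non`, the composite of [`(†𝕄⊛_mod)_α → (†𝕄⊛_mod)_A`] with the component at `v_ℚ` of the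
localization homomorphism of (i) maps the ring of integers of the number field `(†𝕄⊛_mod)_α` into the
submodule constituted by the integral structure on `log(^A𝓕_{v_ℚ})` considered in Proposition 3.1, (ii)"
— abc-iut-L6-t4's `Prop33ii_integersNon` for the model localization homomorphism and the integral
structures `integralPacket`. [claim: Mochizuki2012, status: disputed] -/
theorem prop33ii_integersNon_model [Fintype A] [DecidableEq A] (α : A) :
    Literature.IUT.LogThetaLattice.Prop33ii_integersNon (fun _ : A => K) (packet K A)
      (localizationHom K A) IsNon (integralPacket K A) α := by
  intro vQ hvQ x
  obtain ⟨p, rfl⟩ := Option.isSome_iff_exists.mp hvQ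
  rw [localizationHom_apply, locAt_single]
  refine Subring.subset_closure ⟨_, fun β i => ?_, rfl⟩
  by_cases h : β = α
  · subst h
    simpa using isInt_diag_some K p x i
  · rw [Pi.mulSingle_eq_of_ne h]
    exact isInt_one K (some p) i

/-- **IUTchIII:Prop3.3(ii)** (p. 100), archimedean clause, DISCHARGED for the model: "for each
`v_ℚ ∈ 𝕍_ℚ^arc`, the composite … maps the set of archimedean integers [i.e., elements of absolute value
`≤ 1` at all archimedean primes] of the number field `(†𝕄⊛_mod)_α` into the direct product of subsets
constituted by the integral structures … on the various direct summand … fields of `log(^A𝓕_{v_ℚ})`" —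
abc-iut-L6-t4's `Prop33ii_integersArc` for the model, the archimedean integral structure being the set
`integralPureTensors K A ∞` of pure tensors of vectors of absolute value `≤ 1` ("the direct product of
subsets constituted by the integral structures [unit balls] on the various direct summand … fields", read
on pure tensors). [claim: Mochizuki2012, status: disputed] -/
theorem prop33ii_integersArc_model [Fintype A] [DecidableEq A] (α : A) :
    Literature.IUT.LogThetaLattice.Prop33ii_integersArc (fun _ : A => K) (packet K A)
      (localizationHom K A) IsArc (integralPureTensors K A) α := by
  intro vQ hvQ x hx
  cases hvQ
  rw [localizationHom_apply, locAt_single]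
  refine ⟨_, fun β i => ?_, rfl⟩
  by_cases h : β = α
  · subst h
    simpa using isInt_diag_none K x hx i
  · rw [Pi.mulSingle_eq_of_ne h]
    exact isInt_one K none i

/-! ### Non-vacuity of the integrality clause -/

/-- The multiplication `log(^A𝓕_{v_ℚ}) = ⊗_α (Π_v K_v) → Π_v K_v`, `⊗_α y_α ↦ ∏_α y_α` (an algebra
homomorphism; used only to certify that `integralPacket` is a proper subring). [folklore] -/
private def mulAll [Fintype A] (vQ : VQ) : packet K A vQ →ₐ[ℚ] Loc K vQ :=
  PiTensorProduct.liftAlgHom (MultilinearMap.mkPiAlgebra ℚ A (Loc K vQ))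
    (by simp [MultilinearMap.mkPiAlgebra_apply])
    (fun x y => by simp [MultilinearMap.mkPiAlgebra_apply, Finset.prod_mul_distrib])

/-- `mulAll` on pure tensors. [folklore] -/
@[simp] private theorem mulAll_tprod [Fintype A] (vQ : VQ) (y : A → Loc K vQ) :
    mulAll K A vQ (PiTensorProduct.tprod ℚ y) = ∏ α, y α := by
  simp [mulAll, MultilinearMap.mkPiAlgebra_apply]

/-- The coordinatewise `v`-adic integers `Π_{v|p} 𝒪_{K_v} ⊆ Π_{v|p} K_v` as a subring. [folklore] -/
private def locIntegers (p : Nat.Primes) : Subring (Loc K (some p)) :=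
  ⨅ i : Idx K (some p), Subring.comap (Pi.evalRingHom (fun i : Idx K (some p) => Cpl K (some p) i) i)
    (i.1.adicCompletionIntegers K).toSubring

/-- Membership in `locIntegers`. [folklore] -/
private theorem mem_locIntegers_iff (p : Nat.Primes) (z : Loc K (some p)) :
    z ∈ locIntegers K p ↔ ∀ i : Idx K (some p), z i ∈ i.1.adicCompletionIntegers K := by
  simp [locIntegers, Subring.mem_iInf]

/-- `mulAll` maps the integral structure `integralPacket` into `Π_v 𝒪_{K_v}` (products of integers are
integers). [folklore] -/
private theorem mulAll_mem_locIntegers [Fintype A] (p : Nat.Primes) {t : packet K A (some p)}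
    (ht : t ∈ integralPacket K A (some p)) : mulAll K A (some p) t ∈ locIntegers K p := by
  have hle : integralPacket K A (some p) ≤ (locIntegers K p).comap (mulAll K A (some p)).toRingHom := by
    refine Subring.closure_le.mpr ?_
    rintro _ ⟨y, hy, rfl⟩
    rw [SetLike.mem_coe, Subring.mem_comap, AlgHom.toRingHom_eq_coe, RingHom.coe_coe, mulAll_tprod,
      mem_locIntegers_iff]
    intro i
    rw [Finset.prod_apply]
    exact prod_mem fun α _ => hy α i
  exact hle ht

/-- A rational prime `p` is NOT a unit at a place over `p`: `p⁻¹ ∉ 𝒪_{K_v}` for `v | p`. [folklore] -/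
private theorem inv_natCast_not_mem_adicCompletionIntegers (p : Nat.Primes) (i : Idx K (some p)) :
    algebraMap K (Cpl K (some p) i) ((p : K)⁻¹) ∉ i.1.adicCompletionIntegers K := by
  haveI : Fact p.1.Prime := ⟨p.2⟩
  obtain ⟨v, hv⟩ := i
  have hmem : (p.1 : 𝓞 K) ∈ v.asIdeal := by
    have h := ((Literature.IUT.LogVolume.mem_placesOver_iff v).mp hv).over
    have h2 : ((p.1 : ℕ) : ℤ) ∈ v.asIdeal.under ℤ := h ▸ Ideal.mem_span_singleton_self _
    simpa [Ideal.under_def, Ideal.mem_comap] using h2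
  have hlt : v.valuation K (p.1 : K) < 1 := by
    rw [show (p.1 : K) = algebraMap (𝓞 K) K (p.1 : 𝓞 K) by simp,
      HeightOneSpectrum.valuation_of_algebraMap]
    exact (HeightOneSpectrum.intValuation_lt_one_iff_mem v _).mpr hmem
  have hne : v.valuation K (p.1 : K) ≠ 0 :=
    (Valuation.ne_zero_iff _).mpr (by exact_mod_cast p.2.ne_zero)
  show ¬ ((((p.1 : K)⁻¹ : K) : v.adicCompletion K) ∈ v.adicCompletionIntegers K)
  rw [HeightOneSpectrum.mem_adicCompletionIntegers, HeightOneSpectrum.valuedAdicCompletion_eq_valuation',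
    map_inv₀, inv_le_one₀ (zero_lt_iff.mpr hne), not_le]
  exact hlt

/-- NON-VACUITY of `prop33ii_integersNon_model`: the localization homomorphism does NOT map
non-integers into the integral structure — `p⁻¹ ∈ (†𝕄⊛_mod)_α = K` is not sent into `integralPacket`
at `v_ℚ = p` (so `integralPacket ≠ ⊤` and the integrality clause has content); **IUTchIII:Prop3.3(ii)**
model, kernel check of non-vacuity. [claim: Mochizuki2012, status: disputed] -/
theorem locAt_single_inv_prime_not_mem [Fintype A] [DecidableEq A] (p : Nat.Primes) (α : A) :
    locAt K A (some p) (GlobalPacket.single (fun _ : A => K) α (p : K)⁻¹) ∉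
      integralPacket K A (some p) := by
  intro hmem
  have h := mulAll_mem_locIntegers K A p hmem
  rw [locAt_single, mulAll_tprod, Finset.prod_pi_mulSingle', if_pos (Finset.mem_univ α),
    mem_locIntegers_iff] at h
  obtain ⟨i⟩ := instNonemptyIdx K (some p)
  exact inv_natCast_not_mem_adicCompletionIntegers K p i (h i)

end LocalizationModel

end Literature.IUT.LogThetaLattice
end
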